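import Summits.AtomisticToContinuum.HydrodynamicLimit.Theses.StiffCollisionalRelaxation
import Summits.AtomisticToContinuum.HydrodynamicLimit.Theses.CollisionIsometryCLT
import Summits.AtomisticToContinuum.HydrodynamicLimit.Theorems.StiffCollisionalRelaxationAprioriBoundsFibreDefs
import Summits.AtomisticToContinuum.HydrodynamicLimit.Theorems.StiffCollisionalRelaxationAprioriBoundsPartTwoOfKineticRangeControl
import Summits.AtomisticToContinuum.HydrodynamicLimit.Theorems.ImplosionDichotomyHsEosLowDensity
import Literature.Analysis.FluidPDE.FractionalNSPrescribedEnergyIterationLimit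
import HarnessLib

/-!
# Line `fibre-deficit-transfer` for the crux `AprioriBounds` (stmt-AtomisticToContinuum-14827): the reduction theorem

Support file (`--supports stmt-AtomisticToContinuum-14827`) of the lead prover of the line (skeleton r2,
`Cruxes/AprioriBounds/Lines/fibre_deficit_transfer.lean`).  It makes the skeleton's COMPOSITION importable: the seven registered
stub statements of the line (written out verbatim as hypotheses) imply the crux
`StiffCollisionalRelaxation.AprioriBounds` (= `CollisionIsometryCLT.AprioriBoundsPreShock`) — `aprioriBounds_of_stubs`, the
registered sub-goal of this file — and, with component (ii) discharged by the sibling item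
`GermanoSplitLES.KineticRangeControl` (stmt-9201) through the landed glue `AdiabatCeiling.partTwo_of_kineticRangeControl`,
`aprioriBounds_of_KRC_stubs`.  The glue between the crux prefix and the lever's regularity hypotheses is proved here:
joint continuity of the classical fields on `[0,t] × 𝕋³` (`fields_continuousOn`), continuity of `f_ex`, `f_ex'` at low
density from the LANDED equation of state `hsEosLowDensity_proof` (`eos_continuousOn`), and joint continuity of the density
multiplier `λ₀` in the chamber `2ρσ³ < η₁ ≤ η_eos` (`lam0_continuousOn`).  As stubs land (lever `stub_deficitTransfer`,
`stub_energyMoment`, `stub_partOne_of_tails` this cycle) the corresponding hypotheses are discharged in companion files.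
-/

noncomputable section

open MeasureTheory Filter Set Topology
open scoped ENNReal

namespace Summit.AtomisticToContinuum.HydrodynamicLimit.Theorems.FibreDeficitTransfer

open Literature.MathematicalPhysics.KineticTheory Literature.Analysis.FluidPDE
open Summit.AtomisticToContinuum.HydrodynamicLimit.Theorems.AprioriBoundsNegative (PartOneAt PartTwoAt)
open Summit.AtomisticToContinuum.HydrodynamicLimit.Theorems.VisitLedgerUpscattering (Cfg Flow Flows NiceProfiles)

/-! ## Glue (proved): the crux prefix supplies the regularity hypotheses of the lever -/

/-- A classical solution on `[0, T)` has jointly continuous fields on `[0, t] × 𝕋³` for `t < T`, and `θ, ρ > 0` there. -/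
theorem fields_continuousOn {σ T t : ℝ} {ρ θ : ℝ → T3 → ℝ} {u : ℝ → T3 → V3}
    (hsol : IsHardSphereEulerSolution σ T ρ u θ) (htT : t < T) :
    ContinuousOn (Function.uncurry ρ) (Icc 0 t ×ˢ univ) ∧ ContinuousOn (Function.uncurry θ) (Icc 0 t ×ˢ univ) ∧
      ContinuousOn (Function.uncurry u) (Icc 0 t ×ˢ univ) ∧ (∀ s ∈ Icc 0 t, ∀ x, 0 < θ s x) ∧
      ∀ s ∈ Icc 0 t, ∀ x, 0 < ρ s x := by
  have hsub : Icc 0 t ×ˢ (univ : Set T3) ⊆ Ico 0 T ×ˢ univ :=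
    prod_mono (fun s hs => ⟨hs.1, lt_of_le_of_lt hs.2 htT⟩) subset_rfl
  have hI : ∀ s ∈ Icc 0 t, s ∈ Ico 0 T := fun s hs => ⟨hs.1, lt_of_le_of_lt hs.2 htT⟩
  refine ⟨(Torus.continuousOn_uncurry_of_continuousOn_stLift hsol.smooth_density.continuousOn).mono hsub,
    (Torus.continuousOn_uncurry_of_continuousOn_stLift hsol.smooth_temperature.continuousOn).mono hsub,
    (Torus.continuousOn_uncurry_of_continuousOn_stLift hsol.smooth_velocity.continuousOn).mono hsub,
    fun s hs x => hsol.temperature_pos s (hI s hs) x, fun s hs x => hsol.density_pos s (hI s hs) x⟩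

/-- The low-density equation of state (LANDED, `Theorems.hsEosLowDensity_proof`): a threshold `η_e > 0` below which `f_ex` and
`f_ex'` are continuous on `(0, η_e)`. -/
theorem eos_continuousOn : ∃ ηe : ℝ, 0 < ηe ∧ ContinuousOn hsExcessFreeEnergy (Ioo 0 ηe) ∧
    ContinuousOn (deriv hsExcessFreeEnergy) (Ioo 0 ηe) := by
  obtain ⟨η₀, hη₀, F, hF, hEq, -, -, -⟩ := Theorems.hsEosLowDensity_proof
  refine ⟨η₀, hη₀, ?_, ?_⟩
  · exact (hF.continuousOn.mono (Ioo_subset_Ioo (by linarith) le_rfl)).congr fun x hx => hEq ⟨hx.1.le, hx.2⟩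
  · have hdF : ContinuousOn (deriv F) (Ioo 0 η₀) :=
      (hF.deriv.continuousOn).mono (Ioo_subset_Ioo (by linarith) le_rfl)
    refine hdF.congr fun x hx => ?_
    have hloc : hsExcessFreeEnergy =ᶠ[𝓝 x] F := by
      have hopen : Ioo (0 : ℝ) η₀ ∈ 𝓝 x := Ioo_mem_nhds hx.1 hx.2
      filter_upwards [hopen] with y hy
      exact hEq ⟨hy.1.le, hy.2⟩
    exact hloc.deriv_eq

/-- In the chamber `ρσ³ < η_e` (with `ρ, θ > 0` and jointly continuous fields) the density multiplier `λ₀` is jointly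
continuous on `[0, t] × 𝕋³`. -/
theorem lam0_continuousOn {σ t ηe : ℝ} {ρ θ : ℝ → T3 → ℝ} {u : ℝ → T3 → V3} (hσ : 0 < σ)
    (hfe : ContinuousOn hsExcessFreeEnergy (Ioo 0 ηe)) (hdfe : ContinuousOn (deriv hsExcessFreeEnergy) (Ioo 0 ηe))
    (hρc : ContinuousOn (Function.uncurry ρ) (Icc 0 t ×ˢ univ)) (hθc : ContinuousOn (Function.uncurry θ) (Icc 0 t ×ˢ univ))
    (huc : ContinuousOn (Function.uncurry u) (Icc 0 t ×ˢ univ))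
    (hρ0 : ∀ s ∈ Icc 0 t, ∀ x, 0 < ρ s x) (hθ0 : ∀ s ∈ Icc 0 t, ∀ x, 0 < θ s x)
    (hcham : ∀ s ∈ Icc 0 t, ∀ x, ρ s x * σ ^ 3 < ηe) :
    ContinuousOn (fun p : ℝ × T3 => lam0 σ (ρ p.1 p.2) (θ p.1 p.2) (u p.1 p.2)) (Icc 0 t ×ˢ univ) := by
  have hρ' : ContinuousOn (fun p : ℝ × T3 => ρ p.1 p.2) (Icc 0 t ×ˢ univ) := hρc
  have hθ' : ContinuousOn (fun p : ℝ × T3 => θ p.1 p.2) (Icc 0 t ×ˢ univ) := hθc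
  have hu' : ContinuousOn (fun p : ℝ × T3 => u p.1 p.2) (Icc 0 t ×ˢ univ) := huc
  have hpos : ∀ p ∈ Icc 0 t ×ˢ (univ : Set T3), 0 < ρ p.1 p.2 ∧ 0 < θ p.1 p.2 := fun p hp =>
    ⟨hρ0 p.1 hp.1 p.2, hθ0 p.1 hp.1 p.2⟩
  have hη : ContinuousOn (fun p : ℝ × T3 => ρ p.1 p.2 * σ ^ 3) (Icc 0 t ×ˢ univ) := hρ'.mul continuousOn_const
  have hηmem : MapsTo (fun p : ℝ × T3 => ρ p.1 p.2 * σ ^ 3) (Icc 0 t ×ˢ univ) (Ioo 0 ηe) := fun p hp =>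
    ⟨mul_pos (hpos p hp).1 (pow_pos hσ 3), hcham p.1 hp.1 p.2⟩
  unfold lam0
  refine ((((((hρ'.log fun p hp => (hpos p hp).1.ne').sub (continuousOn_const.mul
    (hθ'.log fun p hp => (hpos p hp).2.ne'))).sub ?_).add continuousOn_const).add (hfe.comp hη hηmem)).add
    (hη.mul (hdfe.comp hη hηmem)))
  exact ((hu'.norm.pow 2).div (continuousOn_const.mul hθ') fun p hp => mul_ne_zero two_ne_zero (hpos p hp).2.ne')


/-! ## The composition -/

/-- Component (i) under the crux prefix from the statements of stubs 1, 3, 4, 5 (inputs) and 6, 7 (lever + assembly):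
thresholds `σ₀ := min (min σ₁ σ₃) (min σ₅ (1/2))`, `η₁ := min (min η¹ η³) (min η⁵ η_e)`. -/
theorem partOne_of_stubs
    (h1 : ∀ (a₀ θ₀ : T3 → ℝ) (u₀ : T3 → V3), Continuous a₀ → Continuous θ₀ → Continuous u₀ → (∀ x, 0 < a₀ x) → (∀ x, 0 < θ₀ x) → ∃ σ₀ : ℝ, 0 < σ₀ ∧ ∃ η₁ : ℝ, 0 < η₁ ∧ ∀ σ : ℝ, 0 < σ → σ < σ₀ → ∀ (T : ℝ) (ρ θ : ℝ → T3 → ℝ) (u : ℝ → T3 → V3), IsHardSphereEulerSolution σ T ρ u θ → ∀ Φ : (N : ℕ) → HardSphereFlow (Torus.geometry (Fin 3)) (hsDiameter σ N) (N + 1), TendstoHydroFieldsAt (fun N => localGibbsLaw σ a₀ u₀ θ₀ N (Φ N)) Φ ρ u θ 0 → ∀ t : ℝ, 0 < t → t < T → (∀ s ∈ Icc 0 t, ∀ x, 2 * ρ s x * σ ^ 3 < η₁) → LinearHydroRateAt σ a₀ θ₀ u₀ ρ θ u Φ t)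
    (h3 : ∀ (a₀ θ₀ : T3 → ℝ) (u₀ : T3 → V3), Continuous a₀ → Continuous θ₀ → Continuous u₀ → (∀ x, 0 < a₀ x) → (∀ x, 0 < θ₀ x) → ∃ σ₀ : ℝ, 0 < σ₀ ∧ ∃ η₁ : ℝ, 0 < η₁ ∧ ∀ σ : ℝ, 0 < σ → σ < σ₀ → ∀ (T : ℝ) (ρ θ : ℝ → T3 → ℝ) (u : ℝ → T3 → V3), IsHardSphereEulerSolution σ T ρ u θ → ∀ Φ : (N : ℕ) → HardSphereFlow (Torus.geometry (Fin 3)) (hsDiameter σ N) (N + 1), TendstoHydroFieldsAt (fun N => localGibbsLaw σ a₀ u₀ θ₀ N (Φ N)) Φ ρ u θ 0 → ∀ t : ℝ, 0 < t → t < T → (∀ s ∈ Icc 0 t, ∀ x, 2 * ρ s x * σ ^ 3 < η₁) → TiltedExcessAt σ a₀ θ₀ u₀ ρ θ u t)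
    (h4 : ∀ (σ : ℝ) (a₀ θ₀ : T3 → ℝ) (u₀ : T3 → V3) (Φ : (N : ℕ) → HardSphereFlow (Torus.geometry (Fin 3)) (hsDiameter σ N) (N + 1)), 0 < σ → σ ≤ 1 / 2 → NiceProfiles a₀ θ₀ u₀ → EnergyMomentAt σ a₀ θ₀ u₀ Φ)
    (h5 : ∀ (a₀ θ₀ : T3 → ℝ) (u₀ : T3 → V3), Continuous a₀ → Continuous θ₀ → Continuous u₀ → (∀ x, 0 < a₀ x) → (∀ x, 0 < θ₀ x) → ∃ σ₀ : ℝ, 0 < σ₀ ∧ ∃ η₁ : ℝ, 0 < η₁ ∧ ∀ σ : ℝ, 0 < σ → σ < σ₀ → ∀ (T : ℝ) (ρ θ : ℝ → T3 → ℝ) (u : ℝ → T3 → V3), IsHardSphereEulerSolution σ T ρ u θ → ∀ Φ : (N : ℕ) → HardSphereFlow (Torus.geometry (Fin 3)) (hsDiameter σ N) (N + 1), TendstoHydroFieldsAt (fun N => localGibbsLaw σ a₀ u₀ θ₀ N (Φ N)) Φ ρ u θ 0 → ∀ t : ℝ, 0 < t → t < T → (∀ s ∈ Icc 0 t, ∀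 x, 2 * ρ s x * σ ^ 3 < η₁) → FarTailAt σ a₀ θ₀ u₀ Φ t)
    (h6 : ∀ (σ : ℝ) (a₀ θ₀ : T3 → ℝ) (u₀ : T3 → V3) (ρ θ : ℝ → T3 → ℝ) (u : ℝ → T3 → V3) (Φ : (N : ℕ) → HardSphereFlow (Torus.geometry (Fin 3)) (hsDiameter σ N) (N + 1)) (t : ℝ), 0 < σ → σ < 1 / 2 → NiceProfiles a₀ θ₀ u₀ → 0 < t → ContinuousOn (Function.uncurry ρ) (Icc 0 t ×ˢ univ) → ContinuousOn (Function.uncurry θ) (Icc 0 t ×ˢ univ) → ContinuousOn (Function.uncurry u) (Icc 0 t ×ˢ univ) → (∀ s ∈ Icc 0 t, ∀ x, 0 < θ s x) → ContinuousOn (fun p : ℝ × T3 => lam0 σ (ρ p.1 p.2) (θ p.1 p.2) (u p.1 p.2)) (Icc 0 t ×ˢ univ) → LinearHydroRateAt σ a₀ θ₀ u₀ ρ θ u Φ t → TiltedExcessAt σ a₀ θ₀ u₀ ρ θ u t → EnergyMomentAt σ a₀ θ₀ u₀ Φ → BulkTailAt σ a₀ θ₀ u₀ Φ t)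
    (h7 : ∀ (σ : ℝ) (a₀ θ₀ : T3 → ℝ) (u₀ : T3 → V3) (Φ : (N : ℕ) → HardSphereFlow (Torus.geometry (Fin 3)) (hsDiameter σ N) (N + 1)) (t : ℝ), 0 < σ → σ ≤ 1 / 2 → NiceProfiles a₀ θ₀ u₀ → 0 < t → BulkTailAt σ a₀ θ₀ u₀ Φ t → FarTailAt σ a₀ θ₀ u₀ Φ t → PartOneAt σ a₀ θ₀ u₀ Φ t) :
    ∀ (a₀ θ₀ : T3 → ℝ) (u₀ : T3 → V3), Continuous a₀ → Continuous θ₀ → Continuous u₀ →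
      (∀ x, 0 < a₀ x) → (∀ x, 0 < θ₀ x) →
      ∃ σ₀ : ℝ, 0 < σ₀ ∧ ∃ η₁ : ℝ, 0 < η₁ ∧ ∀ σ : ℝ, 0 < σ → σ < σ₀ →
        ∀ (T : ℝ) (ρ θ : ℝ → T3 → ℝ) (u : ℝ → T3 → V3), IsHardSphereEulerSolution σ T ρ u θ →
        ∀ Φ : (N : ℕ) → HardSphereFlow (Torus.geometry (Fin 3)) (hsDiameter σ N) (N + 1),
          TendstoHydroFieldsAt (fun N => localGibbsLaw σ a₀ u₀ θ₀ N (Φ N)) Φ ρ u θ 0 →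
          ∀ t : ℝ, 0 < t → t < T → (∀ s ∈ Icc 0 t, ∀ x, 2 * ρ s x * σ ^ 3 < η₁) →
            PartOneAt σ a₀ θ₀ u₀ Φ t := by
  intro a₀ θ₀ u₀ ha hθ hu ha0 hθ0
  have hP : NiceProfiles a₀ θ₀ u₀ := ⟨ha, hθ, hu, ha0, hθ0⟩
  obtain ⟨σ₁, hσ₁, η₁', hη₁', H1⟩ := h1 a₀ θ₀ u₀ ha hθ hu ha0 hθ0
  obtain ⟨σ₃, hσ₃, η₃', hη₃', H3⟩ := h3 a₀ θ₀ u₀ ha hθ hu ha0 hθ0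
  obtain ⟨σ₅, hσ₅, η₅', hη₅', H5⟩ := h5 a₀ θ₀ u₀ ha hθ hu ha0 hθ0
  obtain ⟨ηe, hηe, hfe, hdfe⟩ := eos_continuousOn
  have H4 := h4
  have H6 := h6
  have H7 := h7
  refine ⟨min (min σ₁ σ₃) (min σ₅ (1 / 2)), lt_min (lt_min hσ₁ hσ₃) (lt_min hσ₅ one_half_pos),
    min (min η₁' η₃') (min η₅' ηe), lt_min (lt_min hη₁' hη₃') (lt_min hη₅' hηe), ?_⟩
  intro σ hσ hσlt T ρ θ u hsol Φ hLLN t ht htT hdil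
  simp only [lt_min_iff] at hσlt hdil
  obtain ⟨⟨hs1, hs3⟩, hs5, hshalf⟩ := hσlt
  have hRate : LinearHydroRateAt σ a₀ θ₀ u₀ ρ θ u Φ t :=
    H1 σ hσ hs1 T ρ θ u hsol Φ hLLN t ht htT (fun s hs x => (hdil s hs x).1.1)
  have hExc : TiltedExcessAt σ a₀ θ₀ u₀ ρ θ u t :=
    H3 σ hσ hs3 T ρ θ u hsol Φ hLLN t ht htT (fun s hs x => (hdil s hs x).1.2)
  have hFar : FarTailAt σ a₀ θ₀ u₀ Φ t :=
    H5 σ hσ hs5 T ρ θ u hsol Φ hLLN t ht htT (fun s hs x => (hdil s hs x).2.1)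
  have hMom : EnergyMomentAt σ a₀ θ₀ u₀ Φ := H4 σ a₀ θ₀ u₀ Φ hσ hshalf.le hP
  obtain ⟨hρc, hθc, huc, hθpos, hρpos⟩ := fields_continuousOn hsol htT
  have hcham : ∀ s ∈ Icc 0 t, ∀ x, ρ s x * σ ^ 3 < ηe := fun s hs x => by
    have h := (hdil s hs x).2.2
    have h0 : 0 < ρ s x * σ ^ 3 := mul_pos (hρpos s hs x) (pow_pos hσ 3)
    linarith
  have hΛ := lam0_continuousOn hσ hfe hdfe hρc hθc huc hρpos hθpos hcham
  have hBulk : BulkTailAt σ a₀ θ₀ u₀ Φ t :=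
    H6 σ a₀ θ₀ u₀ ρ θ u Φ t hσ hshalf hP ht hρc hθc huc hθpos hΛ hRate hExc hMom
  exact H7 σ a₀ θ₀ u₀ Φ t hσ hshalf.le hP ht hBulk hFar


/-- **The reduction theorem of the line** (registered sub-goal `aprioriBounds_of_stubs`): the seven registered stub
statements of the line `fibre-deficit-transfer` imply the crux `StiffCollisionalRelaxation.AprioriBounds` BY NAME. -/
theorem aprioriBounds_of_stubs : (∀ (a₀ θ₀ : T3 → ℝ) (u₀ : T3 → V3), Continuous a₀ → Continuous θ₀ → Continuous u₀ → (∀ x, 0 < a₀ x) → (∀ x, 0 < θ₀ x) → ∃ σ₀ : ℝ, 0 < σ₀ ∧ ∃ η₁ : ℝ, 0 < η₁ ∧ ∀ σ : ℝ, 0 < σ → σ < σ₀ → ∀ (T : ℝ) (ρ θ : ℝ → T3 → ℝ) (u : ℝ → T3 → V3), IsHardSphereEulerSolution σ T ρ u θ → ∀ Φ : (N : ℕ) → HardSphereFlow (Torus.geometry (Fin 3)) (hsDiameter σ N) (N + 1), TendstoHydroFieldsAt (fun N => localGibbsLaw σ a₀ u₀ θ₀ N (Φ N)) Φ ρ u θ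 0 → ∀ t : ℝ, 0 < t → t < T → (∀ s ∈ Icc 0 t, ∀ x, 2 * ρ s x * σ ^ 3 < η₁) → LinearHydroRateAt σ a₀ θ₀ u₀ ρ θ u Φ t) → (∀ (a₀ θ₀ : T3 → ℝ) (u₀ : T3 → V3), Continuous a₀ → Continuous θ₀ → Continuous u₀ → (∀ x, 0 < a₀ x) → (∀ x, 0 < θ₀ x) → ∃ σ₀ : ℝ, 0 < σ₀ ∧ ∃ η₁ : ℝ, 0 < η₁ ∧ ∀ σ : ℝ, 0 < σ → σ < σ₀ → ∀ (T : ℝ) (ρ θ : ℝ → T3 → ℝ) (u : ℝ → T3 → V3), IsHardSphereEulerSolution σ T ρ u θ → ∀ Φ : (N : ℕ) → HardSphereFlow (Torus.geometry (Fin 3)) (hsDiameter σ N) (N + 1), TendstoHydroFieldsAt (fun N => localGibbsLaw σ a₀ u₀ θ₀ N (Φ N)) Φ ρ u θ 0 → ∀ t : ℝ, 0 < t → t < T → (∀ s ∈ Icc 0 t, ∀ x, 2 * ρ s x * σ ^ 3 < η₁) → PartTwoAt σ a₀ θ₀ u₀ Φ t) → (∀ (a₀ θ₀ : T3 → ℝ)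 (u₀ : T3 → V3), Continuous a₀ → Continuous θ₀ → Continuous u₀ → (∀ x, 0 < a₀ x) → (∀ x, 0 < θ₀ x) → ∃ σ₀ : ℝ, 0 < σ₀ ∧ ∃ η₁ : ℝ, 0 < η₁ ∧ ∀ σ : ℝ, 0 < σ → σ < σ₀ → ∀ (T : ℝ) (ρ θ : ℝ → T3 → ℝ) (u : ℝ → T3 → V3), IsHardSphereEulerSolution σ T ρ u θ → ∀ Φ : (N : ℕ) → HardSphereFlow (Torus.geometry (Fin 3)) (hsDiameter σ N) (N + 1), TendstoHydroFieldsAt (fun N => localGibbsLaw σ a₀ u₀ θ₀ N (Φ N)) Φ ρ u θ 0 → ∀ t : ℝ, 0 < t → t < T → (∀ s ∈ Icc 0 t, ∀ x, 2 * ρ s x * σ ^ 3 < η₁) → TiltedExcessAt σ a₀ θ₀ u₀ ρ θ u t) → (∀ (σ : ℝ) (a₀ θ₀ : T3 → ℝ) (u₀ : T3 → V3) (Φ : (N : ℕ) → HardSphereFlow (Torus.geometry (Fin 3)) (hsDiameter σ N) (N + 1)), 0 < σ → σ ≤ 1 / 2 → NiceProfiles a₀ θ₀ u₀ → EnergyMomentAt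 σ a₀ θ₀ u₀ Φ) → (∀ (a₀ θ₀ : T3 → ℝ) (u₀ : T3 → V3), Continuous a₀ → Continuous θ₀ → Continuous u₀ → (∀ x, 0 < a₀ x) → (∀ x, 0 < θ₀ x) → ∃ σ₀ : ℝ, 0 < σ₀ ∧ ∃ η₁ : ℝ, 0 < η₁ ∧ ∀ σ : ℝ, 0 < σ → σ < σ₀ → ∀ (T : ℝ) (ρ θ : ℝ → T3 → ℝ) (u : ℝ → T3 → V3), IsHardSphereEulerSolution σ T ρ u θ → ∀ Φ : (N : ℕ) → HardSphereFlow (Torus.geometry (Fin 3)) (hsDiameter σ N) (N + 1), TendstoHydroFieldsAt (fun N => localGibbsLaw σ a₀ u₀ θ₀ N (Φ N)) Φ ρ u θ 0 → ∀ t : ℝ, 0 < t → t < T → (∀ s ∈ Icc 0 t, ∀ x, 2 * ρ s x * σ ^ 3 < η₁) → FarTailAt σ a₀ θ₀ u₀ Φ t) → (∀ (σ : ℝ) (a₀ θ₀ : T3 → ℝ) (u₀ : T3 → V3) (ρ θ : ℝ → T3 → ℝ) (u : ℝ → T3 → V3) (Φ : (N : ℕ) → HardSphereFlow (Torus.geometry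 (Fin 3)) (hsDiameter σ N) (N + 1)) (t : ℝ), 0 < σ → σ < 1 / 2 → NiceProfiles a₀ θ₀ u₀ → 0 < t → ContinuousOn (Function.uncurry ρ) (Icc 0 t ×ˢ univ) → ContinuousOn (Function.uncurry θ) (Icc 0 t ×ˢ univ) → ContinuousOn (Function.uncurry u) (Icc 0 t ×ˢ univ) → (∀ s ∈ Icc 0 t, ∀ x, 0 < θ s x) → ContinuousOn (fun p : ℝ × T3 => lam0 σ (ρ p.1 p.2) (θ p.1 p.2) (u p.1 p.2)) (Icc 0 t ×ˢ univ) → LinearHydroRateAt σ a₀ θ₀ u₀ ρ θ u Φ t → TiltedExcessAt σ a₀ θ₀ u₀ ρ θ u t → EnergyMomentAt σ a₀ θ₀ u₀ Φ → BulkTailAt σ a₀ θ₀ u₀ Φ t) → (∀ (σ : ℝ) (a₀ θ₀ : T3 → ℝ) (u₀ : T3 → V3) (Φ : (N : ℕ) → HardSphereFlow (Torus.geometry (Fin 3)) (hsDiameter σ N) (N + 1)) (t : ℝ), 0 < σ → σ ≤ 1 / 2 → NiceProfiles a₀ θ₀ u₀ → 0 < t → BulkTailAt σ a₀ θ₀ u₀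 Φ t → FarTailAt σ a₀ θ₀ u₀ Φ t → PartOneAt σ a₀ θ₀ u₀ Φ t) → Summit.AtomisticToContinuum.HydrodynamicLimit.Theses.StiffCollisionalRelaxation.AprioriBounds := by
  intro h1 h2 h3 h4 h5 h6 h7
  rw [AprioriBoundsNegative.aprioriBounds_iff]
  intro a₀ θ₀ u₀ ha hθ hu ha0 hθ0
  obtain ⟨σ₁, hσ₁, η₁', hη₁', HI⟩ := partOne_of_stubs h1 h3 h4 h5 h6 h7 a₀ θ₀ u₀ ha hθ hu ha0 hθ0
  obtain ⟨σ₂, hσ₂, η₂', hη₂', HII⟩ := h2 a₀ θ₀ u₀ ha hθ hu ha0 hθ0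
  refine ⟨min σ₁ σ₂, lt_min hσ₁ hσ₂, min η₁' η₂', lt_min hη₁' hη₂', ?_⟩
  intro σ hσ hσlt T ρ θ u hsol Φ hLLN t ht htT hdil
  simp only [lt_min_iff] at hσlt hdil
  exact ⟨HI σ hσ hσlt.1 T ρ θ u hsol Φ hLLN t ht htT (fun s hs x => (hdil s hs x).1),
    HII σ hσ hσlt.2 T ρ θ u hsol Φ hLLN t ht htT (fun s hs x => (hdil s hs x).2)⟩

/-- The same composition closes the `CollisionIsometryCLT` copy of the crux (one `Prop`). -/
theorem aprioriBoundsPreShock_of_stubs : (∀ (a₀ θ₀ : T3 → ℝ) (u₀ : T3 → V3), Continuous a₀ → Continuous θ₀ → Continuous u₀ → (∀ x, 0 < a₀ x) → (∀ x, 0 < θ₀ x) → ∃ σ₀ : ℝ, 0 < σ₀ ∧ ∃ η₁ : ℝ, 0 < η₁ ∧ ∀ σ : ℝ, 0 < σ → σ < σ₀ → ∀ (T : ℝ) (ρ θ : ℝ → T3 → ℝ) (u : ℝ → T3 → V3), IsHardSphereEulerSolution σ T ρ u θ → ∀ Φ : (N : ℕ) → HardSphereFlow (Torus.geometry (Fin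 3)) (hsDiameter σ N) (N + 1), TendstoHydroFieldsAt (fun N => localGibbsLaw σ a₀ u₀ θ₀ N (Φ N)) Φ ρ u θ 0 → ∀ t : ℝ, 0 < t → t < T → (∀ s ∈ Icc 0 t, ∀ x, 2 * ρ s x * σ ^ 3 < η₁) → LinearHydroRateAt σ a₀ θ₀ u₀ ρ θ u Φ t) → (∀ (a₀ θ₀ : T3 → ℝ) (u₀ : T3 → V3), Continuous a₀ → Continuous θ₀ → Continuous u₀ → (∀ x, 0 < a₀ x) → (∀ x, 0 < θ₀ x) → ∃ σ₀ : ℝ, 0 < σ₀ ∧ ∃ η₁ : ℝ, 0 < η₁ ∧ ∀ σ : ℝ, 0 < σ → σ < σ₀ → ∀ (T : ℝ) (ρ θ : ℝ → T3 → ℝ) (u : ℝ → T3 → V3), IsHardSphereEulerSolution σ T ρ u θ → ∀ Φ : (N : ℕ) → HardSphereFlow (Torus.geometry (Fin 3)) (hsDiameter σ N) (N + 1), TendstoHydroFieldsAt (fun N => localGibbsLaw σ a₀ u₀ θ₀ N (Φ N)) Φ ρ u θ 0 → ∀ t : ℝ, 0 < t → t < T → (∀ s ∈ Icc 0 t, ∀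 x, 2 * ρ s x * σ ^ 3 < η₁) → PartTwoAt σ a₀ θ₀ u₀ Φ t) → (∀ (a₀ θ₀ : T3 → ℝ) (u₀ : T3 → V3), Continuous a₀ → Continuous θ₀ → Continuous u₀ → (∀ x, 0 < a₀ x) → (∀ x, 0 < θ₀ x) → ∃ σ₀ : ℝ, 0 < σ₀ ∧ ∃ η₁ : ℝ, 0 < η₁ ∧ ∀ σ : ℝ, 0 < σ → σ < σ₀ → ∀ (T : ℝ) (ρ θ : ℝ → T3 → ℝ) (u : ℝ → T3 → V3), IsHardSphereEulerSolution σ T ρ u θ → ∀ Φ : (N : ℕ) → HardSphereFlow (Torus.geometry (Fin 3)) (hsDiameter σ N) (N + 1), TendstoHydroFieldsAt (fun N => localGibbsLaw σ a₀ u₀ θ₀ N (Φ N)) Φ ρ u θ 0 → ∀ t : ℝ, 0 < t → t < T → (∀ s ∈ Icc 0 t, ∀ x, 2 * ρ s x * σ ^ 3 < η₁) → TiltedExcessAt σ a₀ θ₀ u₀ ρ θ u t) → (∀ (σ : ℝ) (a₀ θ₀ : T3 → ℝ) (u₀ : T3 → V3) (Φ : (N : ℕ) → HardSphereFlow (Torus.geometry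 (Fin 3)) (hsDiameter σ N) (N + 1)), 0 < σ → σ ≤ 1 / 2 → NiceProfiles a₀ θ₀ u₀ → EnergyMomentAt σ a₀ θ₀ u₀ Φ) → (∀ (a₀ θ₀ : T3 → ℝ) (u₀ : T3 → V3), Continuous a₀ → Continuous θ₀ → Continuous u₀ → (∀ x, 0 < a₀ x) → (∀ x, 0 < θ₀ x) → ∃ σ₀ : ℝ, 0 < σ₀ ∧ ∃ η₁ : ℝ, 0 < η₁ ∧ ∀ σ : ℝ, 0 < σ → σ < σ₀ → ∀ (T : ℝ) (ρ θ : ℝ → T3 → ℝ) (u : ℝ → T3 → V3), IsHardSphereEulerSolution σ T ρ u θ → ∀ Φ : (N : ℕ) → HardSphereFlow (Torus.geometry (Fin 3)) (hsDiameter σ N) (N + 1), TendstoHydroFieldsAt (fun N => localGibbsLaw σ a₀ u₀ θ₀ N (Φ N)) Φ ρ u θ 0 → ∀ t : ℝ, 0 < t → t < T → (∀ s ∈ Icc 0 t, ∀ x, 2 * ρ s x * σ ^ 3 < η₁) → FarTailAt σ a₀ θ₀ u₀ Φ t) → (∀ (σ : ℝ) (a₀ θ₀ : T3 → ℝ) (u₀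 : T3 → V3) (ρ θ : ℝ → T3 → ℝ) (u : ℝ → T3 → V3) (Φ : (N : ℕ) → HardSphereFlow (Torus.geometry (Fin 3)) (hsDiameter σ N) (N + 1)) (t : ℝ), 0 < σ → σ < 1 / 2 → NiceProfiles a₀ θ₀ u₀ → 0 < t → ContinuousOn (Function.uncurry ρ) (Icc 0 t ×ˢ univ) → ContinuousOn (Function.uncurry θ) (Icc 0 t ×ˢ univ) → ContinuousOn (Function.uncurry u) (Icc 0 t ×ˢ univ) → (∀ s ∈ Icc 0 t, ∀ x, 0 < θ s x) → ContinuousOn (fun p : ℝ × T3 => lam0 σ (ρ p.1 p.2) (θ p.1 p.2) (u p.1 p.2)) (Icc 0 t ×ˢ univ) → LinearHydroRateAt σ a₀ θ₀ u₀ ρ θ u Φ t → TiltedExcessAt σ a₀ θ₀ u₀ ρ θ u t → EnergyMomentAt σ a₀ θ₀ u₀ Φ → BulkTailAt σ a₀ θ₀ u₀ Φ t) → (∀ (σ : ℝ) (a₀ θ₀ : T3 → ℝ) (u₀ : T3 → V3) (Φ : (N : ℕ) → HardSphereFlow (Torus.geometry (Fin 3)) (hsDiameter σ N) (N + 1)) (t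 : ℝ), 0 < σ → σ ≤ 1 / 2 → NiceProfiles a₀ θ₀ u₀ → 0 < t → BulkTailAt σ a₀ θ₀ u₀ Φ t → FarTailAt σ a₀ θ₀ u₀ Φ t → PartOneAt σ a₀ θ₀ u₀ Φ t) → Summit.AtomisticToContinuum.HydrodynamicLimit.Theses.CollisionIsometryCLT.AprioriBoundsPreShock :=
  aprioriBounds_of_stubs

/-- **The docked reduction**: with component (ii) discharged by the sibling item `GermanoSplitLES.KineticRangeControl`
(stmt-AtomisticToContinuum-9201) through the landed glue `AdiabatCeiling.partTwo_of_kineticRangeControl`, the crux reduces to the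
(i)-stubs of the line. -/
theorem aprioriBounds_of_KRC_stubs : Summit.AtomisticToContinuum.HydrodynamicLimit.Theses.GermanoSplitLES.KineticRangeControl → (∀ (a₀ θ₀ : T3 → ℝ) (u₀ : T3 → V3), Continuous a₀ → Continuous θ₀ → Continuous u₀ → (∀ x, 0 < a₀ x) → (∀ x, 0 < θ₀ x) → ∃ σ₀ : ℝ, 0 < σ₀ ∧ ∃ η₁ : ℝ, 0 < η₁ ∧ ∀ σ : ℝ, 0 < σ → σ < σ₀ → ∀ (T : ℝ) (ρ θ : ℝ → T3 → ℝ) (u : ℝ → T3 → V3), IsHardSphereEulerSolution σ T ρ u θ → ∀ Φ : (N : ℕ) → HardSphereFlow (Torus.geometry (Fin 3)) (hsDiameter σ N) (N + 1), TendstoHydroFieldsAt (fun N => localGibbsLaw σ a₀ u₀ θ₀ N (Φ N)) Φ ρ u θ 0 → ∀ t : ℝ, 0 < t → t < T → (∀ s ∈ Icc 0 t, ∀ x, 2 * ρ s x * σ ^ 3 < η₁) → LinearHydroRateAt σ a₀ θ₀ u₀ ρ θ u Φ t) → (∀ (a₀ θ₀ : T3 → ℝ) (u₀ : T3 → V3),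 Continuous a₀ → Continuous θ₀ → Continuous u₀ → (∀ x, 0 < a₀ x) → (∀ x, 0 < θ₀ x) → ∃ σ₀ : ℝ, 0 < σ₀ ∧ ∃ η₁ : ℝ, 0 < η₁ ∧ ∀ σ : ℝ, 0 < σ → σ < σ₀ → ∀ (T : ℝ) (ρ θ : ℝ → T3 → ℝ) (u : ℝ → T3 → V3), IsHardSphereEulerSolution σ T ρ u θ → ∀ Φ : (N : ℕ) → HardSphereFlow (Torus.geometry (Fin 3)) (hsDiameter σ N) (N + 1), TendstoHydroFieldsAt (fun N => localGibbsLaw σ a₀ u₀ θ₀ N (Φ N)) Φ ρ u θ 0 → ∀ t : ℝ, 0 < t → t < T → (∀ s ∈ Icc 0 t, ∀ x, 2 * ρ s x * σ ^ 3 < η₁) → TiltedExcessAt σ a₀ θ₀ u₀ ρ θ u t) → (∀ (σ : ℝ) (a₀ θ₀ : T3 → ℝ) (u₀ : T3 → V3) (Φ : (N : ℕ) → HardSphereFlow (Torus.geometry (Fin 3)) (hsDiameter σ N) (N + 1)), 0 < σ → σ ≤ 1 / 2 → NiceProfiles a₀ θ₀ u₀ → EnergyMomentAt σ a₀ θ₀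 u₀ Φ) → (∀ (a₀ θ₀ : T3 → ℝ) (u₀ : T3 → V3), Continuous a₀ → Continuous θ₀ → Continuous u₀ → (∀ x, 0 < a₀ x) → (∀ x, 0 < θ₀ x) → ∃ σ₀ : ℝ, 0 < σ₀ ∧ ∃ η₁ : ℝ, 0 < η₁ ∧ ∀ σ : ℝ, 0 < σ → σ < σ₀ → ∀ (T : ℝ) (ρ θ : ℝ → T3 → ℝ) (u : ℝ → T3 → V3), IsHardSphereEulerSolution σ T ρ u θ → ∀ Φ : (N : ℕ) → HardSphereFlow (Torus.geometry (Fin 3)) (hsDiameter σ N) (N + 1), TendstoHydroFieldsAt (fun N => localGibbsLaw σ a₀ u₀ θ₀ N (Φ N)) Φ ρ u θ 0 → ∀ t : ℝ, 0 < t → t < T → (∀ s ∈ Icc 0 t, ∀ x, 2 * ρ s x * σ ^ 3 < η₁) → FarTailAt σ a₀ θ₀ u₀ Φ t) → (∀ (σ : ℝ) (a₀ θ₀ : T3 → ℝ) (u₀ : T3 → V3) (ρ θ : ℝ → T3 → ℝ) (u : ℝ → T3 → V3) (Φ : (N : ℕ) → HardSphereFlow (Torus.geometry (Fin 3)) (hsDiameter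 σ N) (N + 1)) (t : ℝ), 0 < σ → σ < 1 / 2 → NiceProfiles a₀ θ₀ u₀ → 0 < t → ContinuousOn (Function.uncurry ρ) (Icc 0 t ×ˢ univ) → ContinuousOn (Function.uncurry θ) (Icc 0 t ×ˢ univ) → ContinuousOn (Function.uncurry u) (Icc 0 t ×ˢ univ) → (∀ s ∈ Icc 0 t, ∀ x, 0 < θ s x) → ContinuousOn (fun p : ℝ × T3 => lam0 σ (ρ p.1 p.2) (θ p.1 p.2) (u p.1 p.2)) (Icc 0 t ×ˢ univ) → LinearHydroRateAt σ a₀ θ₀ u₀ ρ θ u Φ t → TiltedExcessAt σ a₀ θ₀ u₀ ρ θ u t → EnergyMomentAt σ a₀ θ₀ u₀ Φ → BulkTailAt σ a₀ θ₀ u₀ Φ t) → (∀ (σ : ℝ) (a₀ θ₀ : T3 → ℝ) (u₀ : T3 → V3) (Φ : (N : ℕ) → HardSphereFlow (Torus.geometry (Fin 3)) (hsDiameter σ N) (N + 1)) (t : ℝ), 0 < σ → σ ≤ 1 / 2 → NiceProfiles a₀ θ₀ u₀ → 0 < t → BulkTailAt σ a₀ θ₀ u₀ Φ t → FarTailAt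 σ a₀ θ₀ u₀ Φ t → PartOneAt σ a₀ θ₀ u₀ Φ t) → Summit.AtomisticToContinuum.HydrodynamicLimit.Theses.StiffCollisionalRelaxation.AprioriBounds :=
  fun hKRC h1 h3 h4 h5 h6 h7 => aprioriBounds_of_stubs h1 (AdiabatCeiling.partTwo_of_kineticRangeControl hKRC) h3 h4 h5 h6 h7

end Summit.AtomisticToContinuum.HydrodynamicLimit.Theorems.FibreDeficitTransfer

end
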